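import Literature.Algebra.Polynomial.CasasAlvero.Char499Digits
import Literature.Algebra.Polynomial.CasasAlvero.Char499DigitsHigh
import Literature.Algebra.Polynomial.CasasAlvero.Char499DigitsTop
import Literature.Algebra.Polynomial.CasasAlvero.Char499DigitsPeak
import Literature.Algebra.Polynomial.CasasAlvero.Degree7Char499
import Literature.Algebra.Polynomial.CasasAlvero.Pentanomial
import Literature.Algebra.Polynomial.CasasAlvero.Degree6CandidatesPrime
import Literature.Algebra.Polynomial.CasasAlvero.FieldCorollaries
import Literature.Algebra.Polynomial.CasasAlvero.Degree5
import Literature.Algebra.Polynomial.CasasAlvero.Degree6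
import Literature.Algebra.Polynomial.CasasAlvero.DigitReduction
import HarnessLib

/-!
# Casas-Alvero degrees in characteristic 499: the classification away from the digit `8`

Over EVERY field `K` of characteristic `499` and for every degree `d` that is NOT of the form `8·499^k`:
`CA_d(K) ⟺ d = 0 ∨ d = a·499^k` with `1 ≤ a ≤ 7`.  The one digit left out of this file is `a = 8`, for the following reason.  Every bad digit in this
tree is refuted by an explicit `𝔽_p`-rational sparse polynomial with `𝔽_p`-rational witnesses (which lives in every field of characteristic `p`), but the
EXHAUSTIVE search of the translated–scaled normal form `X^8 + a_6 X^6 + … + a_1 X` over `𝔽_499`, in two independent exhaustive implementations (`cls/dfb/dfind_b.py 499:8` — witness-parametrised normal form — and `cls/wsub/wsub.py 499:8` — enumeration of all supports with witness-subset linear algebra; kit jobs j140674, j142557), returns NOTHING: there is no Casas-Alvero octic over `𝔽_499` all of whose Hasse-derivative witnesses lie in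
`𝔽_499`.  Consequently `CA_8` cannot be refuted uniformly over all fields of characteristic `499` by this method (indeed the search says that `CA_8` holds over
the prime field `𝔽_499` itself — a computational statement NOT formalised here), and whether `CA_8` holds over the algebraic closure of `𝔽_499` (whether `499`
is a good prime of degree `8` in the sense of [CastryckLaterveerOunaies2012]) is decided SEPARATELY, in the affirmative, by the `876` kernel-checked scenario certificates of `Degree8Char499Cert01.lean` … `Degree8Char499Cert18.lean` assembled in `Degree8Char499.lean` (`holdsInDegree_eight_of_char_499`: `CA_8` HOLDS over every field of characteristic `499`, so `499` is a GOOD prime for degree `8` and the digit `8` is genuinely positive — which is why no refuting example can exist); `CharFourHundredNinetyNineComplete.lean` combines that theorem with this file into the complete classification (digit set `{1, 2, 3, 4, 5, 6, 7, 8}`).  This file is the example-based half and carves the digit `8` out.  Nothing below depends on the outcome.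
Ingredients: the digit reduction `CA_d ⇒ d = a·p^k ∧ CA_a` (`DigitReduction.lean`, any field); the positive digits `1, 2, 3, 4`
([GrafVonBothmerEtAl2007, Props. 2, 6]), `5` (`Degree5.lean`: `499` is not one of the nine bad primes of degree `5`), `6` (`499` is not among the `54`
candidate bad primes of degree `6` of `Degree6CandidatesPrime.lean`, so `CA_6` holds in characteristic `499` [CastryckLaterveerOunaies2012, Thm. 4]) and `7`
(`Degree7Char499.lean`: `499` is a GOOD prime for degree `7` — the kernel-checked scenario certificates `holdsInDegree_seven_of_char_499`; the bad primes of
degree `7` were computed in [CastryckLaterveerOunaies2012, Thm. 4]); and a refutation of every digit `9 ≤ a ≤ 498` over every field of characteristic `499`: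
`46, 63, 66, 67, 71, 95, 102, 112, 116, 117, 127, 128, 136, 147, 157, 160, 175, 185, 190, 193, 204, 211, 212, 218, 226, 238, 239, 240, 241, 242, 246, 248, 253, 256, 257, 261, 262, 263, 266, 273, 275, 284, 287, 293, 295, 300, 302, 303, 313, 318, 320, 325, 327, 329, 331, 336, 338, 339, 344, 367, 369, 371, 375, 376, 381, 387, 400, 402, 404, 405, 407, 408, 410, 412, 413, 416, 419, 422, 427, 428, 430, 432, 433, 434, 443, 445, 448, 450, 451, 453, 455, 457, 458, 459, 461, 467, 469, 477, 478, 480, 482, 484, 486, 493, 494, 495, 498` by the binomial criterion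
(`m = 5, 26, 11, 3, 5, 43, 14, 48, 45, 21, 16, 40, 14, 24, 45, 67, 46, 54, 12, 39, 50, 79, 39, 63, 19, 63, 70, 4, 110, 99, 11, 7, 65, 94, 53, 41, 4, 85, 83, 50, 50, 48, 47, 91, 122, 39, 79, 144, 85, 25, 12, 122, 31, 70, 117, 94, 59, 123, 50, 54, 46, 58, 24, 14, 29, 16, 105, 109, 75, 29, 202, 115, 14, 143, 55, 81, 132, 49, 47, 131, 105, 3, 188, 48, 85, 204, 154, 64, 71, 112, 52, 220, 88, 154, 26, 171, 93, 96, 11, 57, 219, 85, 178, 66, 236, 64, 2`); and the 383 remaining digits by the sparse `𝔽_499`-examples of `Char499Digits.lean`, `Char499DigitsHigh.lean`, `Char499DigitsTop.lean` and `Char499DigitsPeak.lean`.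
-/

noncomputable section

open Polynomial

set_option maxRecDepth 8192

namespace Literature.Algebra.Polynomial.CasasAlvero

section CharFourHundredNinetyNinePartial

variable (K : Type*) [Field K] [CharP K 499]

/-- `CA_{6·499^k}` over every field of characteristic `499` (`CA_6` itself — the case `k = 0` — holds because `499` is not among the
`54` candidate bad primes of degree `6` of `Degree6CandidatesPrime.lean`, `holdsInDegree_six_of_not_mem`, i.e. `499` is a GOOD prime for degree `6`
[cite: CastryckLaterveerOunaies2012, Thm. 4]). [cite: GrafVonBothmerEtAl2007, Prop. 6] -/
theorem holdsInDegree_six_mul_pow_of_char_499' (k : ℕ) : HoldsInDegree K (6 * 499 ^ k) := by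
  haveI : Fact (Nat.Prime 499) := ⟨by norm_num⟩
  exact holdsInDegree_mul_prime_pow_field K 499 (holdsInDegree_six_of_not_mem (K := AlgebraicClosure K) 499 (by decide)) k

set_option maxHeartbeats 4000000 in
/-- every digit `9 ≤ a < 499` other than `8` fails: `¬ CA_a` over every field of characteristic `499` — the bad-prime computations of
[cite: CastryckLaterveerOunaies2012, Thm. 4] (degrees `≤ 7`) extended to these digits by explicit `𝔽_499`-rational examples and the
binomial criterion (the digit `8` has no `𝔽_499`-rational-witness example and is not treated). [cite: GrafVonBothmerEtAl2007, Prop. 6] -/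
theorem not_holdsInDegree_digit_of_char_fourHundredNinetyNine' {a : ℕ} (hlo : 9 ≤ a) (hap : a < 499) (h8 : a ≠ 8) : ¬ HoldsInDegree K a := by
  haveI : Fact (Nat.Prime 499) := ⟨by norm_num⟩
  interval_cases a
  · exact not_holdsInDegree_nine_of_char_499 K
  · exact not_holdsInDegree_ten_of_char_499 K
  · exact not_holdsInDegree_eleven_of_char_499 K
  · exact not_holdsInDegree_twelve_of_char_499 K
  · exact not_holdsInDegree_thirteen_of_char_499 K
  · exact not_holdsInDegree_fourteen_of_char_499 K
  · exact not_holdsInDegree_fifteen_of_char_499 K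
  · exact not_holdsInDegree_sixteen_of_char_499 K
  · exact not_holdsInDegree_seventeen_of_char_499 K
  · exact not_holdsInDegree_eighteen_of_char_499 K
  · exact not_holdsInDegree_nineteen_of_char_499 K
  · exact not_holdsInDegree_twenty_of_char_499 K
  · exact not_holdsInDegree_twentyOne_of_char_499 K
  · exact not_holdsInDegree_twentyTwo_of_char_499 K
  · exact not_holdsInDegree_twentyThree_of_char_499 K
  · exact not_holdsInDegree_twentyFour_of_char_499 K
  · exact not_holdsInDegree_twentyFive_of_char_499 K
  · exact not_holdsInDegree_twentySix_of_char_499 K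
  · exact not_holdsInDegree_twentySeven_of_char_499 K
  · exact not_holdsInDegree_twentyEight_of_char_499 K
  · exact not_holdsInDegree_twentyNine_of_char_499 K
  · exact not_holdsInDegree_thirty_of_char_499 K
  · exact not_holdsInDegree_thirtyOne_of_char_499 K
  · exact not_holdsInDegree_thirtyTwo_of_char_499 K
  · exact not_holdsInDegree_thirtyThree_of_char_499 K
  · exact not_holdsInDegree_thirtyFour_of_char_499 K
  · exact not_holdsInDegree_thirtyFive_of_char_499 K
  · exact not_holdsInDegree_thirtySix_of_char_499 K
  · exact not_holdsInDegree_thirtySeven_of_char_499 K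
  · exact not_holdsInDegree_thirtyEight_of_char_499 K
  · exact not_holdsInDegree_thirtyNine_of_char_499 K
  · exact not_holdsInDegree_forty_of_char_499 K
  · exact not_holdsInDegree_fortyOne_of_char_499 K
  · exact not_holdsInDegree_fortyTwo_of_char_499 K
  · exact not_holdsInDegree_fortyThree_of_char_499 K
  · exact not_holdsInDegree_fortyFour_of_char_499 K
  · exact not_holdsInDegree_fortyFive_of_char_499 K
  · exact not_holdsInDegree_of_choose_modEq_one K 499 (d := 46) (m := 5) (by norm_num) (by norm_num) (by decide)
  · exact not_holdsInDegree_fortySeven_of_char_499 K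
  · exact not_holdsInDegree_fortyEight_of_char_499 K
  · exact not_holdsInDegree_fortyNine_of_char_499 K
  · exact not_holdsInDegree_fifty_of_char_499 K
  · exact not_holdsInDegree_fiftyOne_of_char_499 K
  · exact not_holdsInDegree_fiftyTwo_of_char_499 K
  · exact not_holdsInDegree_fiftyThree_of_char_499 K
  · exact not_holdsInDegree_fiftyFour_of_char_499 K
  · exact not_holdsInDegree_fiftyFive_of_char_499 K
  · exact not_holdsInDegree_fiftySix_of_char_499 K
  · exact not_holdsInDegree_fiftySeven_of_char_499 K
  · exact not_holdsInDegree_fiftyEight_of_char_499 K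
  · exact not_holdsInDegree_fiftyNine_of_char_499 K
  · exact not_holdsInDegree_sixty_of_char_499 K
  · exact not_holdsInDegree_sixtyOne_of_char_499 K
  · exact not_holdsInDegree_sixtyTwo_of_char_499 K
  · exact not_holdsInDegree_of_choose_modEq_one K 499 (d := 63) (m := 26) (by norm_num) (by norm_num) (by decide)
  · exact not_holdsInDegree_sixtyFour_of_char_499 K
  · exact not_holdsInDegree_sixtyFive_of_char_499 K
  · exact not_holdsInDegree_of_choose_modEq_one K 499 (d := 66) (m := 11) (by norm_num) (by norm_num) (by decide)
  · exact not_holdsInDegree_of_choose_modEq_one K 499 (d := 67) (m := 3) (by norm_num) (by norm_num) (by decide)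
  · exact not_holdsInDegree_sixtyEight_of_char_499 K
  · exact not_holdsInDegree_sixtyNine_of_char_499 K
  · exact not_holdsInDegree_seventy_of_char_499 K
  · exact not_holdsInDegree_of_choose_modEq_one K 499 (d := 71) (m := 5) (by norm_num) (by norm_num) (by decide)
  · exact not_holdsInDegree_seventyTwo_of_char_499 K
  · exact not_holdsInDegree_seventyThree_of_char_499 K
  · exact not_holdsInDegree_seventyFour_of_char_499 K
  · exact not_holdsInDegree_seventyFive_of_char_499 K
  · exact not_holdsInDegree_seventySix_of_char_499 K
  · exact not_holdsInDegree_seventySeven_of_char_499 K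
  · exact not_holdsInDegree_seventyEight_of_char_499 K
  · exact not_holdsInDegree_seventyNine_of_char_499 K
  · exact not_holdsInDegree_eighty_of_char_499 K
  · exact not_holdsInDegree_eightyOne_of_char_499 K
  · exact not_holdsInDegree_eightyTwo_of_char_499 K
  · exact not_holdsInDegree_eightyThree_of_char_499 K
  · exact not_holdsInDegree_eightyFour_of_char_499 K
  · exact not_holdsInDegree_eightyFive_of_char_499 K
  · exact not_holdsInDegree_eightySix_of_char_499 K
  · exact not_holdsInDegree_eightySeven_of_char_499 K
  · exact not_holdsInDegree_eightyEight_of_char_499 K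
  · exact not_holdsInDegree_eightyNine_of_char_499 K
  · exact not_holdsInDegree_ninety_of_char_499 K
  · exact not_holdsInDegree_ninetyOne_of_char_499 K
  · exact not_holdsInDegree_ninetyTwo_of_char_499 K
  · exact not_holdsInDegree_ninetyThree_of_char_499 K
  · exact not_holdsInDegree_ninetyFour_of_char_499 K
  · exact not_holdsInDegree_of_choose_modEq_one K 499 (d := 95) (m := 43) (by norm_num) (by norm_num) (by decide)
  · exact not_holdsInDegree_ninetySix_of_char_499 K
  · exact not_holdsInDegree_ninetySeven_of_char_499 K
  · exact not_holdsInDegree_ninetyEight_of_char_499 K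
  · exact not_holdsInDegree_ninetyNine_of_char_499 K
  · exact not_holdsInDegree_oneHundred_of_char_499 K
  · exact not_holdsInDegree_oneHundredOne_of_char_499 K
  · exact not_holdsInDegree_of_choose_modEq_one K 499 (d := 102) (m := 14) (by norm_num) (by norm_num) (by decide)
  · exact not_holdsInDegree_oneHundredThree_of_char_499 K
  · exact not_holdsInDegree_oneHundredFour_of_char_499 K
  · exact not_holdsInDegree_oneHundredFive_of_char_499 K
  · exact not_holdsInDegree_oneHundredSix_of_char_499 K
  · exact not_holdsInDegree_oneHundredSeven_of_char_499 K
  · exact not_holdsInDegree_oneHundredEight_of_char_499 K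
  · exact not_holdsInDegree_oneHundredNine_of_char_499 K
  · exact not_holdsInDegree_oneHundredTen_of_char_499 K
  · exact not_holdsInDegree_oneHundredEleven_of_char_499 K
  · exact not_holdsInDegree_of_choose_modEq_one K 499 (d := 112) (m := 48) (by norm_num) (by norm_num) (by decide)
  · exact not_holdsInDegree_oneHundredThirteen_of_char_499 K
  · exact not_holdsInDegree_oneHundredFourteen_of_char_499 K
  · exact not_holdsInDegree_oneHundredFifteen_of_char_499 K
  · exact not_holdsInDegree_of_choose_modEq_one K 499 (d := 116) (m := 45) (by norm_num) (by norm_num) (by decide)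
  · exact not_holdsInDegree_of_choose_modEq_one K 499 (d := 117) (m := 21) (by norm_num) (by norm_num) (by decide)
  · exact not_holdsInDegree_oneHundredEighteen_of_char_499 K
  · exact not_holdsInDegree_oneHundredNineteen_of_char_499 K
  · exact not_holdsInDegree_oneHundredTwenty_of_char_499 K
  · exact not_holdsInDegree_oneHundredTwentyOne_of_char_499 K
  · exact not_holdsInDegree_oneHundredTwentyTwo_of_char_499 K
  · exact not_holdsInDegree_oneHundredTwentyThree_of_char_499 K
  · exact not_holdsInDegree_oneHundredTwentyFour_of_char_499 K
  · exact not_holdsInDegree_oneHundredTwentyFive_of_char_499 K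
  · exact not_holdsInDegree_oneHundredTwentySix_of_char_499 K
  · exact not_holdsInDegree_of_choose_modEq_one K 499 (d := 127) (m := 16) (by norm_num) (by norm_num) (by decide)
  · exact not_holdsInDegree_of_choose_modEq_one K 499 (d := 128) (m := 40) (by norm_num) (by norm_num) (by decide)
  · exact not_holdsInDegree_oneHundredTwentyNine_of_char_499 K
  · exact not_holdsInDegree_oneHundredThirty_of_char_499 K
  · exact not_holdsInDegree_oneHundredThirtyOne_of_char_499 K
  · exact not_holdsInDegree_oneHundredThirtyTwo_of_char_499 K
  · exact not_holdsInDegree_oneHundredThirtyThree_of_char_499 K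
  · exact not_holdsInDegree_oneHundredThirtyFour_of_char_499 K
  · exact not_holdsInDegree_oneHundredThirtyFive_of_char_499 K
  · exact not_holdsInDegree_of_choose_modEq_one K 499 (d := 136) (m := 14) (by norm_num) (by norm_num) (by decide)
  · exact not_holdsInDegree_oneHundredThirtySeven_of_char_499 K
  · exact not_holdsInDegree_oneHundredThirtyEight_of_char_499 K
  · exact not_holdsInDegree_oneHundredThirtyNine_of_char_499 K
  · exact not_holdsInDegree_oneHundredForty_of_char_499 K
  · exact not_holdsInDegree_oneHundredFortyOne_of_char_499 K
  · exact not_holdsInDegree_oneHundredFortyTwo_of_char_499 K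
  · exact not_holdsInDegree_oneHundredFortyThree_of_char_499 K
  · exact not_holdsInDegree_oneHundredFortyFour_of_char_499 K
  · exact not_holdsInDegree_oneHundredFortyFive_of_char_499 K
  · exact not_holdsInDegree_oneHundredFortySix_of_char_499 K
  · exact not_holdsInDegree_of_choose_modEq_one K 499 (d := 147) (m := 24) (by norm_num) (by norm_num) (by decide)
  · exact not_holdsInDegree_oneHundredFortyEight_of_char_499 K
  · exact not_holdsInDegree_oneHundredFortyNine_of_char_499 K
  · exact not_holdsInDegree_oneHundredFifty_of_char_499 K
  · exact not_holdsInDegree_oneHundredFiftyOne_of_char_499 K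
  · exact not_holdsInDegree_oneHundredFiftyTwo_of_char_499 K
  · exact not_holdsInDegree_oneHundredFiftyThree_of_char_499 K
  · exact not_holdsInDegree_oneHundredFiftyFour_of_char_499 K
  · exact not_holdsInDegree_oneHundredFiftyFive_of_char_499 K
  · exact not_holdsInDegree_oneHundredFiftySix_of_char_499 K
  · exact not_holdsInDegree_of_choose_modEq_one K 499 (d := 157) (m := 45) (by norm_num) (by norm_num) (by decide)
  · exact not_holdsInDegree_oneHundredFiftyEight_of_char_499 K
  · exact not_holdsInDegree_oneHundredFiftyNine_of_char_499 K
  · exact not_holdsInDegree_of_choose_modEq_one K 499 (d := 160) (m := 67) (by norm_num) (by norm_num) (by decide)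
  · exact not_holdsInDegree_oneHundredSixtyOne_of_char_499 K
  · exact not_holdsInDegree_oneHundredSixtyTwo_of_char_499 K
  · exact not_holdsInDegree_oneHundredSixtyThree_of_char_499 K
  · exact not_holdsInDegree_oneHundredSixtyFour_of_char_499 K
  · exact not_holdsInDegree_oneHundredSixtyFive_of_char_499 K
  · exact not_holdsInDegree_oneHundredSixtySix_of_char_499 K
  · exact not_holdsInDegree_oneHundredSixtySeven_of_char_499 K
  · exact not_holdsInDegree_oneHundredSixtyEight_of_char_499 K
  · exact not_holdsInDegree_oneHundredSixtyNine_of_char_499 K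
  · exact not_holdsInDegree_oneHundredSeventy_of_char_499 K
  · exact not_holdsInDegree_oneHundredSeventyOne_of_char_499 K
  · exact not_holdsInDegree_oneHundredSeventyTwo_of_char_499 K
  · exact not_holdsInDegree_oneHundredSeventyThree_of_char_499 K
  · exact not_holdsInDegree_oneHundredSeventyFour_of_char_499 K
  · exact not_holdsInDegree_of_choose_modEq_one K 499 (d := 175) (m := 46) (by norm_num) (by norm_num) (by decide)
  · exact not_holdsInDegree_oneHundredSeventySix_of_char_499 K
  · exact not_holdsInDegree_oneHundredSeventySeven_of_char_499 K
  · exact not_holdsInDegree_oneHundredSeventyEight_of_char_499 K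
  · exact not_holdsInDegree_oneHundredSeventyNine_of_char_499 K
  · exact not_holdsInDegree_oneHundredEighty_of_char_499 K
  · exact not_holdsInDegree_oneHundredEightyOne_of_char_499 K
  · exact not_holdsInDegree_oneHundredEightyTwo_of_char_499 K
  · exact not_holdsInDegree_oneHundredEightyThree_of_char_499 K
  · exact not_holdsInDegree_oneHundredEightyFour_of_char_499 K
  · exact not_holdsInDegree_of_choose_modEq_one K 499 (d := 185) (m := 54) (by norm_num) (by norm_num) (by decide)
  · exact not_holdsInDegree_oneHundredEightySix_of_char_499 K
  · exact not_holdsInDegree_oneHundredEightySeven_of_char_499 K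
  · exact not_holdsInDegree_oneHundredEightyEight_of_char_499 K
  · exact not_holdsInDegree_oneHundredEightyNine_of_char_499 K
  · exact not_holdsInDegree_of_choose_modEq_one K 499 (d := 190) (m := 12) (by norm_num) (by norm_num) (by decide)
  · exact not_holdsInDegree_oneHundredNinetyOne_of_char_499 K
  · exact not_holdsInDegree_oneHundredNinetyTwo_of_char_499 K
  · exact not_holdsInDegree_of_choose_modEq_one K 499 (d := 193) (m := 39) (by norm_num) (by norm_num) (by decide)
  · exact not_holdsInDegree_oneHundredNinetyFour_of_char_499 K
  · exact not_holdsInDegree_oneHundredNinetyFive_of_char_499 K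
  · exact not_holdsInDegree_oneHundredNinetySix_of_char_499 K
  · exact not_holdsInDegree_oneHundredNinetySeven_of_char_499 K
  · exact not_holdsInDegree_oneHundredNinetyEight_of_char_499 K
  · exact not_holdsInDegree_oneHundredNinetyNine_of_char_499 K
  · exact not_holdsInDegree_twoHundred_of_char_499 K
  · exact not_holdsInDegree_twoHundredOne_of_char_499 K
  · exact not_holdsInDegree_twoHundredTwo_of_char_499 K
  · exact not_holdsInDegree_twoHundredThree_of_char_499 K
  · exact not_holdsInDegree_of_choose_modEq_one K 499 (d := 204) (m := 50) (by norm_num) (by norm_num) (by decide)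
  · exact not_holdsInDegree_twoHundredFive_of_char_499 K
  · exact not_holdsInDegree_twoHundredSix_of_char_499 K
  · exact not_holdsInDegree_twoHundredSeven_of_char_499 K
  · exact not_holdsInDegree_twoHundredEight_of_char_499 K
  · exact not_holdsInDegree_twoHundredNine_of_char_499 K
  · exact not_holdsInDegree_twoHundredTen_of_char_499 K
  · exact not_holdsInDegree_of_choose_modEq_one K 499 (d := 211) (m := 79) (by norm_num) (by norm_num) (by decide)
  · exact not_holdsInDegree_of_choose_modEq_one K 499 (d := 212) (m := 39) (by norm_num) (by norm_num) (by decide)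
  · exact not_holdsInDegree_twoHundredThirteen_of_char_499 K
  · exact not_holdsInDegree_twoHundredFourteen_of_char_499 K
  · exact not_holdsInDegree_twoHundredFifteen_of_char_499 K
  · exact not_holdsInDegree_twoHundredSixteen_of_char_499 K
  · exact not_holdsInDegree_twoHundredSeventeen_of_char_499 K
  · exact not_holdsInDegree_of_choose_modEq_one K 499 (d := 218) (m := 63) (by norm_num) (by norm_num) (by decide)
  · exact not_holdsInDegree_twoHundredNineteen_of_char_499 K
  · exact not_holdsInDegree_twoHundredTwenty_of_char_499 K
  · exact not_holdsInDegree_twoHundredTwentyOne_of_char_499 K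
  · exact not_holdsInDegree_twoHundredTwentyTwo_of_char_499 K
  · exact not_holdsInDegree_twoHundredTwentyThree_of_char_499 K
  · exact not_holdsInDegree_twoHundredTwentyFour_of_char_499 K
  · exact not_holdsInDegree_twoHundredTwentyFive_of_char_499 K
  · exact not_holdsInDegree_of_choose_modEq_one K 499 (d := 226) (m := 19) (by norm_num) (by norm_num) (by decide)
  · exact not_holdsInDegree_twoHundredTwentySeven_of_char_499 K
  · exact not_holdsInDegree_twoHundredTwentyEight_of_char_499 K
  · exact not_holdsInDegree_twoHundredTwentyNine_of_char_499 K
  · exact not_holdsInDegree_twoHundredThirty_of_char_499 K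
  · exact not_holdsInDegree_twoHundredThirtyOne_of_char_499 K
  · exact not_holdsInDegree_twoHundredThirtyTwo_of_char_499 K
  · exact not_holdsInDegree_twoHundredThirtyThree_of_char_499 K
  · exact not_holdsInDegree_twoHundredThirtyFour_of_char_499 K
  · exact not_holdsInDegree_twoHundredThirtyFive_of_char_499 K
  · exact not_holdsInDegree_twoHundredThirtySix_of_char_499 K
  · exact not_holdsInDegree_twoHundredThirtySeven_of_char_499 K
  · exact not_holdsInDegree_of_choose_modEq_one K 499 (d := 238) (m := 63) (by norm_num) (by norm_num) (by decide)
  · exact not_holdsInDegree_of_choose_modEq_one K 499 (d := 239) (m := 70) (by norm_num) (by norm_num) (by decide)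
  · exact not_holdsInDegree_of_choose_modEq_one K 499 (d := 240) (m := 4) (by norm_num) (by norm_num) (by decide)
  · exact not_holdsInDegree_of_choose_modEq_one K 499 (d := 241) (m := 110) (by norm_num) (by norm_num) (by decide)
  · exact not_holdsInDegree_of_choose_modEq_one K 499 (d := 242) (m := 99) (by norm_num) (by norm_num) (by decide)
  · exact not_holdsInDegree_twoHundredFortyThree_of_char_499 K
  · exact not_holdsInDegree_twoHundredFortyFour_of_char_499 K
  · exact not_holdsInDegree_twoHundredFortyFive_of_char_499 K
  · exact not_holdsInDegree_of_choose_modEq_one K 499 (d := 246) (m := 11) (by norm_num) (by norm_num) (by decide)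
  · exact not_holdsInDegree_twoHundredFortySeven_of_char_499 K
  · exact not_holdsInDegree_of_choose_modEq_one K 499 (d := 248) (m := 7) (by norm_num) (by norm_num) (by decide)
  · exact not_holdsInDegree_twoHundredFortyNine_of_char_499 K
  · exact not_holdsInDegree_twoHundredFifty_of_char_499 K
  · exact not_holdsInDegree_twoHundredFiftyOne_of_char_499 K
  · exact not_holdsInDegree_twoHundredFiftyTwo_of_char_499 K
  · exact not_holdsInDegree_of_choose_modEq_one K 499 (d := 253) (m := 65) (by norm_num) (by norm_num) (by decide)
  · exact not_holdsInDegree_twoHundredFiftyFour_of_char_499 K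
  · exact not_holdsInDegree_twoHundredFiftyFive_of_char_499 K
  · exact not_holdsInDegree_of_choose_modEq_one K 499 (d := 256) (m := 94) (by norm_num) (by norm_num) (by decide)
  · exact not_holdsInDegree_of_choose_modEq_one K 499 (d := 257) (m := 53) (by norm_num) (by norm_num) (by decide)
  · exact not_holdsInDegree_twoHundredFiftyEight_of_char_499 K
  · exact not_holdsInDegree_twoHundredFiftyNine_of_char_499 K
  · exact not_holdsInDegree_twoHundredSixty_of_char_499 K
  · exact not_holdsInDegree_of_choose_modEq_one K 499 (d := 261) (m := 41) (by norm_num) (by norm_num) (by decide)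
  · exact not_holdsInDegree_of_choose_modEq_one K 499 (d := 262) (m := 4) (by norm_num) (by norm_num) (by decide)
  · exact not_holdsInDegree_of_choose_modEq_one K 499 (d := 263) (m := 85) (by norm_num) (by norm_num) (by decide)
  · exact not_holdsInDegree_twoHundredSixtyFour_of_char_499 K
  · exact not_holdsInDegree_twoHundredSixtyFive_of_char_499 K
  · exact not_holdsInDegree_of_choose_modEq_one K 499 (d := 266) (m := 83) (by norm_num) (by norm_num) (by decide)
  · exact not_holdsInDegree_twoHundredSixtySeven_of_char_499 K
  · exact not_holdsInDegree_twoHundredSixtyEight_of_char_499 K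
  · exact not_holdsInDegree_twoHundredSixtyNine_of_char_499 K
  · exact not_holdsInDegree_twoHundredSeventy_of_char_499 K
  · exact not_holdsInDegree_twoHundredSeventyOne_of_char_499 K
  · exact not_holdsInDegree_twoHundredSeventyTwo_of_char_499 K
  · exact not_holdsInDegree_of_choose_modEq_one K 499 (d := 273) (m := 50) (by norm_num) (by norm_num) (by decide)
  · exact not_holdsInDegree_twoHundredSeventyFour_of_char_499 K
  · exact not_holdsInDegree_of_choose_modEq_one K 499 (d := 275) (m := 50) (by norm_num) (by norm_num) (by decide)
  · exact not_holdsInDegree_twoHundredSeventySix_of_char_499 K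
  · exact not_holdsInDegree_twoHundredSeventySeven_of_char_499 K
  · exact not_holdsInDegree_twoHundredSeventyEight_of_char_499 K
  · exact not_holdsInDegree_twoHundredSeventyNine_of_char_499 K
  · exact not_holdsInDegree_twoHundredEighty_of_char_499 K
  · exact not_holdsInDegree_twoHundredEightyOne_of_char_499 K
  · exact not_holdsInDegree_twoHundredEightyTwo_of_char_499 K
  · exact not_holdsInDegree_twoHundredEightyThree_of_char_499 K
  · exact not_holdsInDegree_of_choose_modEq_one K 499 (d := 284) (m := 48) (by norm_num) (by norm_num) (by decide)
  · exact not_holdsInDegree_twoHundredEightyFive_of_char_499 K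
  · exact not_holdsInDegree_twoHundredEightySix_of_char_499 K
  · exact not_holdsInDegree_of_choose_modEq_one K 499 (d := 287) (m := 47) (by norm_num) (by norm_num) (by decide)
  · exact not_holdsInDegree_twoHundredEightyEight_of_char_499 K
  · exact not_holdsInDegree_twoHundredEightyNine_of_char_499 K
  · exact not_holdsInDegree_twoHundredNinety_of_char_499 K
  · exact not_holdsInDegree_twoHundredNinetyOne_of_char_499 K
  · exact not_holdsInDegree_twoHundredNinetyTwo_of_char_499 K
  · exact not_holdsInDegree_of_choose_modEq_one K 499 (d := 293) (m := 91) (by norm_num) (by norm_num) (by decide)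
  · exact not_holdsInDegree_twoHundredNinetyFour_of_char_499 K
  · exact not_holdsInDegree_of_choose_modEq_one K 499 (d := 295) (m := 122) (by norm_num) (by norm_num) (by decide)
  · exact not_holdsInDegree_twoHundredNinetySix_of_char_499 K
  · exact not_holdsInDegree_twoHundredNinetySeven_of_char_499 K
  · exact not_holdsInDegree_twoHundredNinetyEight_of_char_499 K
  · exact not_holdsInDegree_twoHundredNinetyNine_of_char_499 K
  · exact not_holdsInDegree_of_choose_modEq_one K 499 (d := 300) (m := 39) (by norm_num) (by norm_num) (by decide)
  · exact not_holdsInDegree_threeHundredOne_of_char_499 K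
  · exact not_holdsInDegree_of_choose_modEq_one K 499 (d := 302) (m := 79) (by norm_num) (by norm_num) (by decide)
  · exact not_holdsInDegree_of_choose_modEq_one K 499 (d := 303) (m := 144) (by norm_num) (by norm_num) (by decide)
  · exact not_holdsInDegree_threeHundredFour_of_char_499 K
  · exact not_holdsInDegree_threeHundredFive_of_char_499 K
  · exact not_holdsInDegree_threeHundredSix_of_char_499 K
  · exact not_holdsInDegree_threeHundredSeven_of_char_499 K
  · exact not_holdsInDegree_threeHundredEight_of_char_499 K
  · exact not_holdsInDegree_threeHundredNine_of_char_499 K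
  · exact not_holdsInDegree_threeHundredTen_of_char_499 K
  · exact not_holdsInDegree_threeHundredEleven_of_char_499 K
  · exact not_holdsInDegree_threeHundredTwelve_of_char_499 K
  · exact not_holdsInDegree_of_choose_modEq_one K 499 (d := 313) (m := 85) (by norm_num) (by norm_num) (by decide)
  · exact not_holdsInDegree_threeHundredFourteen_of_char_499 K
  · exact not_holdsInDegree_threeHundredFifteen_of_char_499 K
  · exact not_holdsInDegree_threeHundredSixteen_of_char_499 K
  · exact not_holdsInDegree_threeHundredSeventeen_of_char_499 K
  · exact not_holdsInDegree_of_choose_modEq_one K 499 (d := 318) (m := 25) (by norm_num) (by norm_num) (by decide)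
  · exact not_holdsInDegree_threeHundredNineteen_of_char_499 K
  · exact not_holdsInDegree_of_choose_modEq_one K 499 (d := 320) (m := 12) (by norm_num) (by norm_num) (by decide)
  · exact not_holdsInDegree_threeHundredTwentyOne_of_char_499 K
  · exact not_holdsInDegree_threeHundredTwentyTwo_of_char_499 K
  · exact not_holdsInDegree_threeHundredTwentyThree_of_char_499 K
  · exact not_holdsInDegree_threeHundredTwentyFour_of_char_499 K
  · exact not_holdsInDegree_of_choose_modEq_one K 499 (d := 325) (m := 122) (by norm_num) (by norm_num) (by decide)
  · exact not_holdsInDegree_threeHundredTwentySix_of_char_499 K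
  · exact not_holdsInDegree_of_choose_modEq_one K 499 (d := 327) (m := 31) (by norm_num) (by norm_num) (by decide)
  · exact not_holdsInDegree_threeHundredTwentyEight_of_char_499 K
  · exact not_holdsInDegree_of_choose_modEq_one K 499 (d := 329) (m := 70) (by norm_num) (by norm_num) (by decide)
  · exact not_holdsInDegree_threeHundredThirty_of_char_499 K
  · exact not_holdsInDegree_of_choose_modEq_one K 499 (d := 331) (m := 117) (by norm_num) (by norm_num) (by decide)
  · exact not_holdsInDegree_threeHundredThirtyTwo_of_char_499 K
  · exact not_holdsInDegree_threeHundredThirtyThree_of_char_499 K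
  · exact not_holdsInDegree_threeHundredThirtyFour_of_char_499 K
  · exact not_holdsInDegree_threeHundredThirtyFive_of_char_499 K
  · exact not_holdsInDegree_of_choose_modEq_one K 499 (d := 336) (m := 94) (by norm_num) (by norm_num) (by decide)
  · exact not_holdsInDegree_threeHundredThirtySeven_of_char_499 K
  · exact not_holdsInDegree_of_choose_modEq_one K 499 (d := 338) (m := 59) (by norm_num) (by norm_num) (by decide)
  · exact not_holdsInDegree_of_choose_modEq_one K 499 (d := 339) (m := 123) (by norm_num) (by norm_num) (by decide)
  · exact not_holdsInDegree_threeHundredForty_of_char_499 K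
  · exact not_holdsInDegree_threeHundredFortyOne_of_char_499 K
  · exact not_holdsInDegree_threeHundredFortyTwo_of_char_499 K
  · exact not_holdsInDegree_threeHundredFortyThree_of_char_499 K
  · exact not_holdsInDegree_of_choose_modEq_one K 499 (d := 344) (m := 50) (by norm_num) (by norm_num) (by decide)
  · exact not_holdsInDegree_threeHundredFortyFive_of_char_499 K
  · exact not_holdsInDegree_threeHundredFortySix_of_char_499 K
  · exact not_holdsInDegree_threeHundredFortySeven_of_char_499 K
  · exact not_holdsInDegree_threeHundredFortyEight_of_char_499 K
  · exact not_holdsInDegree_threeHundredFortyNine_of_char_499 K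
  · exact not_holdsInDegree_threeHundredFifty_of_char_499 K
  · exact not_holdsInDegree_threeHundredFiftyOne_of_char_499 K
  · exact not_holdsInDegree_threeHundredFiftyTwo_of_char_499 K
  · exact not_holdsInDegree_threeHundredFiftyThree_of_char_499 K
  · exact not_holdsInDegree_threeHundredFiftyFour_of_char_499 K
  · exact not_holdsInDegree_threeHundredFiftyFive_of_char_499 K
  · exact not_holdsInDegree_threeHundredFiftySix_of_char_499 K
  · exact not_holdsInDegree_threeHundredFiftySeven_of_char_499 K
  · exact not_holdsInDegree_threeHundredFiftyEight_of_char_499 K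
  · exact not_holdsInDegree_threeHundredFiftyNine_of_char_499 K
  · exact not_holdsInDegree_threeHundredSixty_of_char_499 K
  · exact not_holdsInDegree_threeHundredSixtyOne_of_char_499 K
  · exact not_holdsInDegree_threeHundredSixtyTwo_of_char_499 K
  · exact not_holdsInDegree_threeHundredSixtyThree_of_char_499 K
  · exact not_holdsInDegree_threeHundredSixtyFour_of_char_499 K
  · exact not_holdsInDegree_threeHundredSixtyFive_of_char_499 K
  · exact not_holdsInDegree_threeHundredSixtySix_of_char_499 K
  · exact not_holdsInDegree_of_choose_modEq_one K 499 (d := 367) (m := 54) (by norm_num) (by norm_num) (by decide)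
  · exact not_holdsInDegree_threeHundredSixtyEight_of_char_499 K
  · exact not_holdsInDegree_of_choose_modEq_one K 499 (d := 369) (m := 46) (by norm_num) (by norm_num) (by decide)
  · exact not_holdsInDegree_threeHundredSeventy_of_char_499 K
  · exact not_holdsInDegree_of_choose_modEq_one K 499 (d := 371) (m := 58) (by norm_num) (by norm_num) (by decide)
  · exact not_holdsInDegree_threeHundredSeventyTwo_of_char_499 K
  · exact not_holdsInDegree_threeHundredSeventyThree_of_char_499 K
  · exact not_holdsInDegree_threeHundredSeventyFour_of_char_499 K
  · exact not_holdsInDegree_of_choose_modEq_one K 499 (d := 375) (m := 24) (by norm_num) (by norm_num) (by decide)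
  · exact not_holdsInDegree_of_choose_modEq_one K 499 (d := 376) (m := 14) (by norm_num) (by norm_num) (by decide)
  · exact not_holdsInDegree_threeHundredSeventySeven_of_char_499 K
  · exact not_holdsInDegree_threeHundredSeventyEight_of_char_499 K
  · exact not_holdsInDegree_threeHundredSeventyNine_of_char_499 K
  · exact not_holdsInDegree_threeHundredEighty_of_char_499 K
  · exact not_holdsInDegree_of_choose_modEq_one K 499 (d := 381) (m := 29) (by norm_num) (by norm_num) (by decide)
  · exact not_holdsInDegree_threeHundredEightyTwo_of_char_499 K
  · exact not_holdsInDegree_threeHundredEightyThree_of_char_499 K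
  · exact not_holdsInDegree_threeHundredEightyFour_of_char_499 K
  · exact not_holdsInDegree_threeHundredEightyFive_of_char_499 K
  · exact not_holdsInDegree_threeHundredEightySix_of_char_499 K
  · exact not_holdsInDegree_of_choose_modEq_one K 499 (d := 387) (m := 16) (by norm_num) (by norm_num) (by decide)
  · exact not_holdsInDegree_threeHundredEightyEight_of_char_499 K
  · exact not_holdsInDegree_threeHundredEightyNine_of_char_499 K
  · exact not_holdsInDegree_threeHundredNinety_of_char_499 K
  · exact not_holdsInDegree_threeHundredNinetyOne_of_char_499 K
  · exact not_holdsInDegree_threeHundredNinetyTwo_of_char_499 K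
  · exact not_holdsInDegree_threeHundredNinetyThree_of_char_499 K
  · exact not_holdsInDegree_threeHundredNinetyFour_of_char_499 K
  · exact not_holdsInDegree_threeHundredNinetyFive_of_char_499 K
  · exact not_holdsInDegree_threeHundredNinetySix_of_char_499 K
  · exact not_holdsInDegree_threeHundredNinetySeven_of_char_499 K
  · exact not_holdsInDegree_threeHundredNinetyEight_of_char_499 K
  · exact not_holdsInDegree_threeHundredNinetyNine_of_char_499 K
  · exact not_holdsInDegree_of_choose_modEq_one K 499 (d := 400) (m := 105) (by norm_num) (by norm_num) (by decide)
  · exact not_holdsInDegree_fourHundredOne_of_char_499 K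
  · exact not_holdsInDegree_of_choose_modEq_one K 499 (d := 402) (m := 109) (by norm_num) (by norm_num) (by decide)
  · exact not_holdsInDegree_fourHundredThree_of_char_499 K
  · exact not_holdsInDegree_of_choose_modEq_one K 499 (d := 404) (m := 75) (by norm_num) (by norm_num) (by decide)
  · exact not_holdsInDegree_of_choose_modEq_one K 499 (d := 405) (m := 29) (by norm_num) (by norm_num) (by decide)
  · exact not_holdsInDegree_fourHundredSix_of_char_499 K
  · exact not_holdsInDegree_of_choose_modEq_one K 499 (d := 407) (m := 202) (by norm_num) (by norm_num) (by decide)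
  · exact not_holdsInDegree_of_choose_modEq_one K 499 (d := 408) (m := 115) (by norm_num) (by norm_num) (by decide)
  · exact not_holdsInDegree_fourHundredNine_of_char_499 K
  · exact not_holdsInDegree_of_choose_modEq_one K 499 (d := 410) (m := 14) (by norm_num) (by norm_num) (by decide)
  · exact not_holdsInDegree_fourHundredEleven_of_char_499 K
  · exact not_holdsInDegree_of_choose_modEq_one K 499 (d := 412) (m := 143) (by norm_num) (by norm_num) (by decide)
  · exact not_holdsInDegree_of_choose_modEq_one K 499 (d := 413) (m := 55) (by norm_num) (by norm_num) (by decide)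
  · exact not_holdsInDegree_fourHundredFourteen_of_char_499 K
  · exact not_holdsInDegree_fourHundredFifteen_of_char_499 K
  · exact not_holdsInDegree_of_choose_modEq_one K 499 (d := 416) (m := 81) (by norm_num) (by norm_num) (by decide)
  · exact not_holdsInDegree_fourHundredSeventeen_of_char_499 K
  · exact not_holdsInDegree_fourHundredEighteen_of_char_499 K
  · exact not_holdsInDegree_of_choose_modEq_one K 499 (d := 419) (m := 132) (by norm_num) (by norm_num) (by decide)
  · exact not_holdsInDegree_fourHundredTwenty_of_char_499 K
  · exact not_holdsInDegree_fourHundredTwentyOne_of_char_499 K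
  · exact not_holdsInDegree_of_choose_modEq_one K 499 (d := 422) (m := 49) (by norm_num) (by norm_num) (by decide)
  · exact not_holdsInDegree_fourHundredTwentyThree_of_char_499 K
  · exact not_holdsInDegree_fourHundredTwentyFour_of_char_499 K
  · exact not_holdsInDegree_fourHundredTwentyFive_of_char_499 K
  · exact not_holdsInDegree_fourHundredTwentySix_of_char_499 K
  · exact not_holdsInDegree_of_choose_modEq_one K 499 (d := 427) (m := 47) (by norm_num) (by norm_num) (by decide)
  · exact not_holdsInDegree_of_choose_modEq_one K 499 (d := 428) (m := 131) (by norm_num) (by norm_num) (by decide)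
  · exact not_holdsInDegree_fourHundredTwentyNine_of_char_499 K
  · exact not_holdsInDegree_of_choose_modEq_one K 499 (d := 430) (m := 105) (by norm_num) (by norm_num) (by decide)
  · exact not_holdsInDegree_fourHundredThirtyOne_of_char_499 K
  · exact not_holdsInDegree_of_choose_modEq_one K 499 (d := 432) (m := 3) (by norm_num) (by norm_num) (by decide)
  · exact not_holdsInDegree_of_choose_modEq_one K 499 (d := 433) (m := 188) (by norm_num) (by norm_num) (by decide)
  · exact not_holdsInDegree_of_choose_modEq_one K 499 (d := 434) (m := 48) (by norm_num) (by norm_num) (by decide)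
  · exact not_holdsInDegree_fourHundredThirtyFive_of_char_499 K
  · exact not_holdsInDegree_fourHundredThirtySix_of_char_499 K
  · exact not_holdsInDegree_fourHundredThirtySeven_of_char_499 K
  · exact not_holdsInDegree_fourHundredThirtyEight_of_char_499 K
  · exact not_holdsInDegree_fourHundredThirtyNine_of_char_499 K
  · exact not_holdsInDegree_fourHundredForty_of_char_499 K
  · exact not_holdsInDegree_fourHundredFortyOne_of_char_499 K
  · exact not_holdsInDegree_fourHundredFortyTwo_of_char_499 K
  · exact not_holdsInDegree_of_choose_modEq_one K 499 (d := 443) (m := 85) (by norm_num) (by norm_num) (by decide)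
  · exact not_holdsInDegree_fourHundredFortyFour_of_char_499 K
  · exact not_holdsInDegree_of_choose_modEq_one K 499 (d := 445) (m := 204) (by norm_num) (by norm_num) (by decide)
  · exact not_holdsInDegree_fourHundredFortySix_of_char_499 K
  · exact not_holdsInDegree_fourHundredFortySeven_of_char_499 K
  · exact not_holdsInDegree_of_choose_modEq_one K 499 (d := 448) (m := 154) (by norm_num) (by norm_num) (by decide)
  · exact not_holdsInDegree_fourHundredFortyNine_of_char_499 K
  · exact not_holdsInDegree_of_choose_modEq_one K 499 (d := 450) (m := 64) (by norm_num) (by norm_num) (by decide)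
  · exact not_holdsInDegree_of_choose_modEq_one K 499 (d := 451) (m := 71) (by norm_num) (by norm_num) (by decide)
  · exact not_holdsInDegree_fourHundredFiftyTwo_of_char_499 K
  · exact not_holdsInDegree_of_choose_modEq_one K 499 (d := 453) (m := 112) (by norm_num) (by norm_num) (by decide)
  · exact not_holdsInDegree_fourHundredFiftyFour_of_char_499 K
  · exact not_holdsInDegree_of_choose_modEq_one K 499 (d := 455) (m := 52) (by norm_num) (by norm_num) (by decide)
  · exact not_holdsInDegree_fourHundredFiftySix_of_char_499 K
  · exact not_holdsInDegree_of_choose_modEq_one K 499 (d := 457) (m := 220) (by norm_num) (by norm_num) (by decide)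
  · exact not_holdsInDegree_of_choose_modEq_one K 499 (d := 458) (m := 88) (by norm_num) (by norm_num) (by decide)
  · exact not_holdsInDegree_of_choose_modEq_one K 499 (d := 459) (m := 154) (by norm_num) (by norm_num) (by decide)
  · exact not_holdsInDegree_fourHundredSixty_of_char_499 K
  · exact not_holdsInDegree_of_choose_modEq_one K 499 (d := 461) (m := 26) (by norm_num) (by norm_num) (by decide)
  · exact not_holdsInDegree_fourHundredSixtyTwo_of_char_499 K
  · exact not_holdsInDegree_fourHundredSixtyThree_of_char_499 K
  · exact not_holdsInDegree_fourHundredSixtyFour_of_char_499 K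
  · exact not_holdsInDegree_fourHundredSixtyFive_of_char_499 K
  · exact not_holdsInDegree_fourHundredSixtySix_of_char_499 K
  · exact not_holdsInDegree_of_choose_modEq_one K 499 (d := 467) (m := 171) (by norm_num) (by norm_num) (by decide)
  · exact not_holdsInDegree_fourHundredSixtyEight_of_char_499 K
  · exact not_holdsInDegree_of_choose_modEq_one K 499 (d := 469) (m := 93) (by norm_num) (by norm_num) (by decide)
  · exact not_holdsInDegree_fourHundredSeventy_of_char_499 K
  · exact not_holdsInDegree_fourHundredSeventyOne_of_char_499 K
  · exact not_holdsInDegree_fourHundredSeventyTwo_of_char_499 K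
  · exact not_holdsInDegree_fourHundredSeventyThree_of_char_499 K
  · exact not_holdsInDegree_fourHundredSeventyFour_of_char_499 K
  · exact not_holdsInDegree_fourHundredSeventyFive_of_char_499 K
  · exact not_holdsInDegree_fourHundredSeventySix_of_char_499 K
  · exact not_holdsInDegree_of_choose_modEq_one K 499 (d := 477) (m := 96) (by norm_num) (by norm_num) (by decide)
  · exact not_holdsInDegree_of_choose_modEq_one K 499 (d := 478) (m := 11) (by norm_num) (by norm_num) (by decide)
  · exact not_holdsInDegree_fourHundredSeventyNine_of_char_499 K
  · exact not_holdsInDegree_of_choose_modEq_one K 499 (d := 480) (m := 57) (by norm_num) (by norm_num) (by decide)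
  · exact not_holdsInDegree_fourHundredEightyOne_of_char_499 K
  · exact not_holdsInDegree_of_choose_modEq_one K 499 (d := 482) (m := 219) (by norm_num) (by norm_num) (by decide)
  · exact not_holdsInDegree_fourHundredEightyThree_of_char_499 K
  · exact not_holdsInDegree_of_choose_modEq_one K 499 (d := 484) (m := 85) (by norm_num) (by norm_num) (by decide)
  · exact not_holdsInDegree_fourHundredEightyFive_of_char_499 K
  · exact not_holdsInDegree_of_choose_modEq_one K 499 (d := 486) (m := 178) (by norm_num) (by norm_num) (by decide)
  · exact not_holdsInDegree_fourHundredEightySeven_of_char_499 K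
  · exact not_holdsInDegree_fourHundredEightyEight_of_char_499 K
  · exact not_holdsInDegree_fourHundredEightyNine_of_char_499 K
  · exact not_holdsInDegree_fourHundredNinety_of_char_499 K
  · exact not_holdsInDegree_fourHundredNinetyOne_of_char_499 K
  · exact not_holdsInDegree_fourHundredNinetyTwo_of_char_499 K
  · exact not_holdsInDegree_of_choose_modEq_one K 499 (d := 493) (m := 66) (by norm_num) (by norm_num) (by decide)
  · exact not_holdsInDegree_of_choose_modEq_one K 499 (d := 494) (m := 236) (by norm_num) (by norm_num) (by decide)
  · exact not_holdsInDegree_of_choose_modEq_one K 499 (d := 495) (m := 64) (by norm_num) (by norm_num) (by decide)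
  · exact not_holdsInDegree_fourHundredNinetySix_of_char_499 K
  · exact not_holdsInDegree_fourHundredNinetySeven_of_char_499 K
  · exact not_holdsInDegree_of_choose_modEq_one K 499 (d := 498) (m := 2) (by norm_num) (by norm_num) (by decide)

/-- the positive digits `1 ≤ a ≤ 5`: `CA_{a·499^k}` over every field of characteristic `499`. [cite: GrafVonBothmerEtAl2007, Props. 2, 6]
[cite: CastryckLaterveerOunaies2012, Thm. 4] -/
theorem holdsInDegree_mul_fourHundredNinetyNine_pow_of_le_five' {a : ℕ} (ha0 : 0 < a) (ha5 : a ≤ 5) (k : ℕ) :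
    HoldsInDegree K (a * 499 ^ k) := by
  haveI : Fact (Nat.Prime 499) := ⟨by norm_num⟩
  interval_cases a
  · simpa using holdsInDegree_prime_pow_field K 499 k
  · exact holdsInDegree_two_mul_prime_pow_field K 499 k
  · exact holdsInDegree_three_mul_prime_pow_field K 499 (by norm_num) k
  · exact holdsInDegree_mul_prime_pow_field K 499
      (holdsInDegree_of_le_four_of_charP (AlgebraicClosure K) 499 (by norm_num) le_rfl) k
  · exact holdsInDegree_five_mul_prime_pow_field K 499 (by norm_num) (by norm_num) (by norm_num) (by norm_num)
      (by norm_num) (by norm_num) (by norm_num) (by norm_num) (by norm_num) k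

/-- **characteristic 499, away from the digit `8`**: over every field of characteristic `499` and for every `d ≠ 8·499^k`,
`CA_d ⟺ d = 0 ∨ d = a·499^k` with `1 ≤ a ≤ 7`.  (The degrees `8·499^k` are excluded by hypothesis: no `𝔽_499`-rational-witness
Casas-Alvero octic exists, so the digit `8` is neither refuted nor certified here.) [cite: GrafVonBothmerEtAl2007, Props. 2, 6, 7]
[cite: CastryckLaterveerOunaies2012, Thm. 4] -/
theorem classification_char_fourHundredNinetyNine_partial (d : ℕ) (hd : ∀ k : ℕ, d ≠ 8 * 499 ^ k) :
    HoldsInDegree K d ↔ d = 0 ∨ ∃ k a : ℕ, 0 < a ∧ a ≤ 7 ∧ d = a * 499 ^ k := by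
  haveI : Fact (Nat.Prime 499) := ⟨by norm_num⟩
  constructor
  · intro h
    rcases Nat.eq_zero_or_pos d with rfl | hd0
    · exact Or.inl rfl
    obtain ⟨k, a, ha0, hap, rfl, ha⟩ := digit_of_holdsInDegree K 499 hd0.ne' h
    refine Or.inr ⟨k, a, ha0, ?_, rfl⟩
    by_contra hN
    rcases Nat.lt_or_ge a 9 with hlo | hlo
    · obtain rfl : a = 8 := by omega
      exact hd k rfl
    · by_cases h8 : a = 8
      · subst h8
        exact hd k rfl
      · exact not_holdsInDegree_digit_of_char_fourHundredNinetyNine' K hlo hap h8 ha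
  · rintro (rfl | ⟨k, a, ha0, haN, rfl⟩)
    · exact holdsInDegree_zero K
    · rcases Nat.lt_or_ge a 6 with ha | ha
      · exact holdsInDegree_mul_fourHundredNinetyNine_pow_of_le_five' K ha0 (by omega) k
      · rcases Nat.lt_or_ge a 7 with ha' | ha'
        · obtain rfl : a = 6 := by omega
          exact holdsInDegree_six_mul_pow_of_char_499' K k
        · obtain rfl : a = 7 := le_antisymm haN ha'
          exact holdsInDegree_seven_mul_pow_of_char_499 (K := K) k

/-- **characteristic 499, complete GIVEN `CA_8`**: if the Casas-Alvero property holds over `K` in the degrees `8·499^k` (for instance once `499` is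
certified a good prime of degree `8`, cf. the module docstring — nothing of the kind is proved in this tree), then `CA_d(K) ⟺ d = 0 ∨ d = a·499^k` with
`1 ≤ a ≤ 8`. [cite: GrafVonBothmerEtAl2007, Props. 2, 6, 7] [cite: CastryckLaterveerOunaies2012, Thm. 4] -/
theorem classification_char_fourHundredNinetyNine_of_degree_eight (h8 : ∀ k : ℕ, HoldsInDegree K (8 * 499 ^ k)) (d : ℕ) :
    HoldsInDegree K d ↔ d = 0 ∨ ∃ k a : ℕ, 0 < a ∧ a ≤ 8 ∧ d = a * 499 ^ k := by
  haveI : Fact (Nat.Prime 499) := ⟨by norm_num⟩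
  constructor
  · intro h
    rcases Nat.eq_zero_or_pos d with rfl | hd0
    · exact Or.inl rfl
    obtain ⟨k, a, ha0, hap, rfl, ha⟩ := digit_of_holdsInDegree K 499 hd0.ne' h
    refine Or.inr ⟨k, a, ha0, ?_, rfl⟩
    by_contra hN
    rcases Nat.lt_or_ge a 9 with hlo | hlo
    · exact hN (by omega)
    · by_cases h8' : a = 8
      · exact hN (by omega)
      · exact not_holdsInDegree_digit_of_char_fourHundredNinetyNine' K hlo hap h8' ha
  · rintro (rfl | ⟨k, a, ha0, haN, rfl⟩)
    · exact holdsInDegree_zero K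
    · rcases Nat.lt_or_ge a 6 with ha | ha
      · exact holdsInDegree_mul_fourHundredNinetyNine_pow_of_le_five' K ha0 (by omega) k
      · rcases Nat.lt_or_ge a 7 with ha' | ha'
        · obtain rfl : a = 6 := by omega
          exact holdsInDegree_six_mul_pow_of_char_499' K k
        · rcases Nat.lt_or_ge a 8 with ha'' | ha''
          · obtain rfl : a = 7 := by omega
            exact holdsInDegree_seven_mul_pow_of_char_499 (K := K) k
          · obtain rfl : a = 8 := le_antisymm haN ha''
            exact h8 k

/-- **characteristic 499, complete GIVEN `¬CA_8`**: if the Casas-Alvero property FAILS over `K` in degree `8`, then (leading-digit reduction, forward half,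
any field) it fails in every degree `8·499^k` and `CA_d(K) ⟺ d = 0 ∨ d = a·499^k` with `1 ≤ a ≤ 7`. [cite: GrafVonBothmerEtAl2007, Props. 2, 6, 7]
[cite: CastryckLaterveerOunaies2012, Thm. 4] -/
theorem classification_char_fourHundredNinetyNine_of_not_degree_eight (h8 : ¬ HoldsInDegree K 8) (d : ℕ) :
    HoldsInDegree K d ↔ d = 0 ∨ ∃ k a : ℕ, 0 < a ∧ a ≤ 7 ∧ d = a * 499 ^ k := by
  haveI : Fact (Nat.Prime 499) := ⟨by norm_num⟩
  constructor
  · intro h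
    rcases Nat.eq_zero_or_pos d with rfl | hd0
    · exact Or.inl rfl
    obtain ⟨k, a, ha0, hap, rfl, ha⟩ := digit_of_holdsInDegree K 499 hd0.ne' h
    refine Or.inr ⟨k, a, ha0, ?_, rfl⟩
    by_contra hN
    rcases Nat.lt_or_ge a 9 with hlo | hlo
    · obtain rfl : a = 8 := by omega
      exact h8 ha
    · by_cases h8' : a = 8
      · subst h8'
        exact h8 ha
      · exact not_holdsInDegree_digit_of_char_fourHundredNinetyNine' K hlo hap h8' ha
  · rintro (rfl | ⟨k, a, ha0, haN, rfl⟩)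
    · exact holdsInDegree_zero K
    · rcases Nat.lt_or_ge a 6 with ha | ha
      · exact holdsInDegree_mul_fourHundredNinetyNine_pow_of_le_five' K ha0 (by omega) k
      · rcases Nat.lt_or_ge a 7 with ha' | ha'
        · obtain rfl : a = 6 := by omega
          exact holdsInDegree_six_mul_pow_of_char_499' K k
        · obtain rfl : a = 7 := le_antisymm haN ha'
          exact holdsInDegree_seven_mul_pow_of_char_499 (K := K) k

/-- the set of Casas-Alvero degrees `≤ 249001` other than `8` and `8·499 = 3992` in characteristic `499`, explicitly (corollary of the classification away
from the digit `8`: [cite: GrafVonBothmerEtAl2007, Prop. 6] with [cite: CastryckLaterveerOunaies2012, Thm. 4] and the digit refutations above). -/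
theorem holdsInDegree_iff_mem_of_le_char_fourHundredNinetyNine_sq' {d : ℕ} (hd : d ≤ 249001) (h8 : d ≠ 8) (h8p : d ≠ 3992) :
    HoldsInDegree K d ↔ d ∈ ({0, 1, 2, 3, 4, 5, 6, 7, 499, 998, 1497, 1996, 2495, 2994, 3493, 249001} : Finset ℕ) := by
  have hd' : ∀ k : ℕ, d ≠ 8 * 499 ^ k := by
    intro k
    rcases k with _ | _ | k
    · simpa using h8
    · simpa using h8p
    · intro h
      have : 499 ^ 2 ≤ 499 ^ (k + 1 + 1) := Nat.pow_le_pow_right (by norm_num) (by omega)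
      omega
  rw [classification_char_fourHundredNinetyNine_partial K d hd']
  constructor
  · rintro (rfl | ⟨k, a, ha0, haN, rfl⟩)
    · decide
    · rcases k with _ | _ | _ | k
      · interval_cases a <;> decide
      · interval_cases a <;> decide
      · interval_cases a <;> simp_all
      · exfalso
        have : 499 ^ 3 ≤ a * 499 ^ (k + 1 + 1 + 1) :=
          le_trans (Nat.pow_le_pow_right (by norm_num) (by omega)) (Nat.le_mul_of_pos_left _ ha0)
        omega
  · intro h
    simp only [Finset.mem_insert, Finset.mem_singleton] at h
    rcases h with rfl | rfl | rfl | rfl | rfl | rfl | rfl | rfl | rfl | rfl | rfl | rfl | rfl | rfl | rfl | rfl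
    · exact Or.inl rfl
    · exact Or.inr ⟨0, 1, by norm_num, by norm_num, by norm_num⟩
    · exact Or.inr ⟨0, 2, by norm_num, by norm_num, by norm_num⟩
    · exact Or.inr ⟨0, 3, by norm_num, by norm_num, by norm_num⟩
    · exact Or.inr ⟨0, 4, by norm_num, by norm_num, by norm_num⟩
    · exact Or.inr ⟨0, 5, by norm_num, by norm_num, by norm_num⟩
    · exact Or.inr ⟨0, 6, by norm_num, by norm_num, by norm_num⟩
    · exact Or.inr ⟨0, 7, by norm_num, by norm_num, by norm_num⟩
    · exact Or.inr ⟨1, 1, by norm_num, by norm_num, by norm_num⟩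
    · exact Or.inr ⟨1, 2, by norm_num, by norm_num, by norm_num⟩
    · exact Or.inr ⟨1, 3, by norm_num, by norm_num, by norm_num⟩
    · exact Or.inr ⟨1, 4, by norm_num, by norm_num, by norm_num⟩
    · exact Or.inr ⟨1, 5, by norm_num, by norm_num, by norm_num⟩
    · exact Or.inr ⟨1, 6, by norm_num, by norm_num, by norm_num⟩
    · exact Or.inr ⟨1, 7, by norm_num, by norm_num, by norm_num⟩
    · exact Or.inr ⟨2, 1, by norm_num, by norm_num, by norm_num⟩

end CharFourHundredNinetyNinePartial

end Literature.Algebra.Polynomial.CasasAlvero
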